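import Literature.Geometry.Manifold.DeRhamFundamentalClassPairing
import Literature.AlgebraicTopology.SingularHomology.PoincareDualityCorollaries
import Literature.AlgebraicTopology.SingularHomology.IntersectionFormProofs
import Literature.AlgebraicTopology.SingularHomology.CohomologyRingChange
import Literature.AlgebraicTopology.SingularHomology.BettiNumberBaseChange
import Literature.AlgebraicTopology.SingularHomology.CohomologyFiniteness
import Literature.Topology.FourManifolds.LatticeFormsSylvester
import HarnessLib

/-!
# A real class of positive square forces `b⁺ ≥ 1`

For a closed `ℤ`-oriented topological manifold `X` of dimension `n = k + k` (`μ` any homological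
`ℤ`-orientation, `[X] = μ.fundamentalClass`), the intersection form
`Q_X : Hᵏ(X; ℤ)/T × Hᵏ(X; ℤ)/T → ℤ` (`intersectionForm h μ`) and its positive index
`b⁺ = sigPos Q_X` (Mathlib's `sigPos`: the maximal rank of a sublattice on which `Q_X` is positive
definite), we compare `Q_X` with the **real** cup-product pairing
`(y, y') ↦ ⟨y ∪ y', [X] ⊗ 1⟩` on `Hᵏ(X; ℝ)` (Milnor–Husemoller (1973), §II.1–II.2: the signature of
an integral form is that of its real extension; Gompf–Stipsicz (1999), §1.2, Def. 1.2.1 ff.: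
`b₂⁺` is the dimension of a maximal positive subspace of `H²(X; ℝ)`):

* `kroneckerPairing_cupProduct_ringChange` — on integral classes the real pairing IS the integral
  one: `⟨(a ⊗ 1) ∪ (a' ⊗ 1), [X] ⊗ 1⟩ = ⟨a ∪ a', [X]⟩` (cup product and Kronecker pairing commute
  with the change of coefficients, Hatcher (2002), §3.1 p. 198, §3.2 p. 215).
* `span_range_ringChange_eq_top` — **`Hᵏ(X; ℝ)` is spanned over `ℝ` by integral classes**: the
  images `aᵢ ⊗ 1` of lifts of a `ℤ`-basis `(āᵢ)` of `Hᵏ(X; ℤ)/T` are `ℝ`-linearly independent —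
  test against the DUAL basis `(d̄ⱼ)`, `Q_X(āᵢ, d̄ⱼ) = δᵢⱼ`, which exists because `Q_X` is perfect
  (Poincaré duality, Hatcher Prop. 3.38 / Cor. 3.39, the tree's `isPerfPair_cupPairingModTorsion_holds`)
  — and there are `rank (Hᵏ/T) = bₖ(X; ℚ) = bₖ(X; ℝ) = dim Hᵏ(X; ℝ)` of them
  (`finrank_freeCohomology_eq_bettiNumber_holds`, `bettiNumber_rat_eq_real`,
  `finrank_singularCohomology_eq_bettiNumber_of_field`).
* `exists_cupPairing_self_pos_of_real` — **if some real class `y` has `⟨y ∪ y, [X] ⊗ 1⟩ > 0` then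
  some integral class `a` has `⟨a ∪ a, [X]⟩ > 0`**: otherwise the integral Gram form of the `aᵢ` is
  `≤ 0` on `ℤᵇ`, hence on `ℚᵇ` (homogeneity) and on `ℝᵇ` (density of `ℚᵇ`, continuity), i.e. on all
  of `Hᵏ(X; ℝ)`.
* `one_le_sigPos_intersectionForm_of_cupPairing_self_pos`,
  `one_le_sigPos_intersectionForm_of_real` — hence **`1 ≤ b⁺`** (the rank-one sublattice `ℤ ā` is
  positive definite).

This is the lattice-theoretic step of "`[ω] ∪ [ω] > 0 ⇒ b⁺ ≥ 1`" for closed symplectic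
`4`-manifolds (McDuff–Salamon (2017), proof of Thm. 13.3.11), conjunct (i) of
`Literature.Geometry.Symplectic.canonicalClass_sq_and_adjunction_of_symplectic_four`.
Everything is proved; no definitions, no named facts. Spaces live in `Type` (the universe of the
tree's `ℤ → K` coefficient comparison `kroneckerPairing_ringChange_coeffChange`).

## References

* J. Milnor, D. Husemoller, *Symmetric Bilinear Forms*, Springer (1973), §II.1–II.2, §V.1.
  [MilnorHusemoller1973]
* R. E. Gompf, A. I. Stipsicz, *4-Manifolds and Kirby Calculus*, AMS (1999), §1.2 Def. 1.2.1 ff.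
  [GompfStipsiczGSM1999]
* A. Hatcher, *Algebraic Topology*, CUP (2002), §3.1 p. 198, §3.2 p. 215, §3.3 Prop. 3.38,
  Cor. 3.39. [HatcherAT2002]
* D. McDuff, D. Salamon, *Introduction to Symplectic Topology*, 3rd ed., OUP (2017), proof of
  Thm. 13.3.11. [McDuffSalamon2017]
-/

noncomputable section

open Set Function Module
open Literature.AlgebraicTopology.SingularHomology Literature.Geometry.Manifold

namespace Literature.Topology.FourManifolds

variable {X : Type} [TopologicalSpace X] {k n : ℕ}

/-! ### The real cup pairing on integral classes -/

/-- **On integral classes the real cup pairing is the integral one**: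
`⟨(a ⊗ 1) ∪ (b ⊗ 1), [X] ⊗ 1⟩ = ⟨a ∪ b, [X]⟩` (the change of coefficients `ℤ → ℝ` is
multiplicative, `singularCohomology.ringChange_cupProduct`, and compatible with the Kronecker
pairing, `kroneckerPairing_ringChange_coeffChange`; Hatcher (2002), §3.1 p. 198, §3.2 p. 215).
[cite: HatcherAT2002, §3.1 p. 198 and §3.2 p. 215] -/
theorem kroneckerPairing_cupProduct_ringChange (μ : HomologicalOrientation ℤ X n) (h : k + k = n)
    (a b : singularCohomology ℤ ℤ X k) :
    kroneckerPairing ℝ ℝ X n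
        (cupProduct h (singularCohomology.ringChange (algebraMap ℤ ℝ) X k a)
          (singularCohomology.ringChange (algebraMap ℤ ℝ) X k b))
        (singularHomology.coeffChange X (algebraMap ℤ ℝ : ℤ →+* ℝ).toAddMonoidHom n
          μ.fundamentalClass) =
      (cupPairing μ h a b : ℝ) := by
  rw [← singularCohomology.ringChange_cupProduct, kroneckerPairing_ringChange_coeffChange,
    cupPairing_apply, eq_intCast]

/-- The real cup pairing of integral combinations is the integral Gram form:
`⟨(∑ rᵢ aᵢ ⊗ 1) ∪ (∑ r'ⱼ aⱼ ⊗ 1), [X] ⊗ 1⟩ = ∑ᵢ ∑ⱼ rᵢ r'ⱼ ⟨aᵢ ∪ aⱼ, [X]⟩` (bilinearity).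
[cite: MilnorHusemoller1973, §II.1] -/
theorem kroneckerPairing_cupProduct_sum_smul_ringChange {ι : Type*} [Fintype ι]
    (μ : HomologicalOrientation ℤ X n) (h : k + k = n) (a : ι → singularCohomology ℤ ℤ X k)
    (r r' : ι → ℝ) :
    kroneckerPairing ℝ ℝ X n
        (cupProduct h (∑ i, r i • singularCohomology.ringChange (algebraMap ℤ ℝ) X k (a i))
          (∑ j, r' j • singularCohomology.ringChange (algebraMap ℤ ℝ) X k (a j)))
        (singularHomology.coeffChange X (algebraMap ℤ ℝ : ℤ →+* ℝ).toAddMonoidHom n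
          μ.fundamentalClass) =
      ∑ i, ∑ j, r i * r' j * (cupPairing μ h (a i) (a j) : ℝ) := by
  simp only [map_sum, map_smul, LinearMap.sum_apply, LinearMap.smul_apply, smul_eq_mul,
    kroneckerPairing_cupProduct_ringChange, Finset.mul_sum]
  rw [Finset.sum_comm]
  refine Finset.sum_congr rfl fun i _ ↦ Finset.sum_congr rfl fun j _ ↦ ?_
  ring

/-- The real image of an integral combination: `(∑ mᵢ aᵢ) ⊗ 1 = ∑ mᵢ (aᵢ ⊗ 1)`. [folklore] -/
theorem ringChange_sum_zsmul {ι : Type*} [Fintype ι] (a : ι → singularCohomology ℤ ℤ X k) (m : ι → ℤ) :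
    singularCohomology.ringChange (algebraMap ℤ ℝ) X k (∑ i, m i • a i) =
      ∑ i, (m i : ℝ) • singularCohomology.ringChange (algebraMap ℤ ℝ) X k (a i) := by
  rw [map_sum]
  refine Finset.sum_congr rfl fun i _ ↦ ?_
  rw [map_zsmul, Int.cast_smul_eq_zsmul]

/-! ### Integral classes span real cohomology -/

section Span

variable [T2Space X] [CompactSpace X]

/-- `Hᵏ(X; ℤ)/T` of a closed manifold is a finitely generated free `ℤ`-module. [folklore] -/
theorem finite_and_free_freeCohomology_int [ChartedSpace (EuclideanSpace ℝ (Fin n)) X] (k : ℕ) :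
    Module.Finite ℤ (freeCohomology ℤ X k) ∧ Module.Free ℤ (freeCohomology ℤ X k) :=
  ⟨finite_freeCohomology (finite_singularCohomology_of_compactSpace_of_isPrincipalIdealRing ℤ X n k),
    free_freeCohomology (finite_singularCohomology_of_compactSpace_of_isPrincipalIdealRing ℤ X n k)⟩

/-- **`dim_ℝ Hᵏ(X; ℝ) = rank (Hᵏ(X; ℤ)/T)`** for a closed manifold (both are the `k`-th Betti
number: `finrank_singularCohomology_eq_bettiNumber_of_field`, `bettiNumber_rat_eq_real`,
`finrank_freeCohomology_eq_bettiNumber_holds`; Hatcher (2002), Cor. 3.3 / Cor. 3A.6).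
[cite: HatcherAT2002, §3.1 Cor. 3.3 and §3.A Cor. 3A.6] -/
theorem finrank_singularCohomology_real_eq_finrank_freeCohomology
    [ChartedSpace (EuclideanSpace ℝ (Fin n)) X] (k : ℕ) :
    Module.finrank ℝ (singularCohomology ℝ ℝ X k) = Module.finrank ℤ (freeCohomology ℤ X k) := by
  rw [finrank_singularCohomology_eq_bettiNumber_of_field, ← bettiNumber_rat_eq_real]
  exact (finrank_freeCohomology_eq_bettiNumber_holds (n := n) k).symm

/-- **Lifts of a `ℤ`-basis of `Hᵏ(X; ℤ)/T` are `ℝ`-linearly independent in `Hᵏ(X; ℝ)`** (dimension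
`n = k + k`): test a real relation `∑ rᵢ (aᵢ ⊗ 1) = 0` against `dⱼ ⊗ 1`, `(d̄ⱼ)` the basis of
`Hᵏ/T` dual to `(āᵢ)` under the perfect pairing `Q_X` (Poincaré duality, Hatcher (2002),
Prop. 3.38): `0 = ∑ᵢ rᵢ Q_X(āᵢ, d̄ⱼ) = rⱼ`. [cite: HatcherAT2002, §3.3 Prop. 3.38 and Cor. 3.39] -/
theorem linearIndependent_ringChange_of_basis [ChartedSpace (EuclideanSpace ℝ (Fin n)) X]
    {ι : Type*} [Fintype ι] (μ : HomologicalOrientation ℤ X n)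
    (h : k + k = n) (bF : Module.Basis ι ℤ (freeCohomology ℤ X k))
    (a : ι → singularCohomology ℤ ℤ X k) (ha : ∀ i, freeCohomology.mk (a i) = bF i) :
    LinearIndependent ℝ (fun i ↦ singularCohomology.ringChange (algebraMap ℤ ℝ) X k (a i)) := by
  classical
  obtain ⟨hfin, hfree⟩ := finite_and_free_freeCohomology_int (X := X) (n := n) k
  haveI := hfin
  haveI := hfree
  have hP : (intersectionForm h μ).IsPerfPair := isPerfPair_cupPairingModTorsion_holds (R := ℤ)
  -- the dual basis `d j`, `Q (bF i) (d j) = δ_{ij}`, and lifts `e j`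
  choose d hd using fun j ↦ hP.bijective_right.2 (bF.coord j)
  choose e he using fun j ↦ freeCohomology.mk_surjective (R := ℤ) (X := X) (k := k) (d j)
  have hQ : ∀ i j, cupPairing μ h (a i) (e j) = if i = j then 1 else 0 := by
    intro i j
    have h1 := LinearMap.congr_fun (hd j) (bF i)
    rw [LinearMap.flip_apply, Module.Basis.coord_apply, bF.repr_self, Finsupp.single_apply] at h1
    rw [← intersectionForm_mk_mk h μ, ha, he, h1]
  rw [Fintype.linearIndependent_iff]
  intro g hg j
  -- pair the relation with `e j ⊗ 1`
  have h1 := congrArg (fun c ↦ kroneckerPairing ℝ ℝ X n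
    (cupProduct h c (singularCohomology.ringChange (algebraMap ℤ ℝ) X k (e j)))
    (singularHomology.coeffChange X (algebraMap ℤ ℝ : ℤ →+* ℝ).toAddMonoidHom n μ.fundamentalClass)) hg
  simp only [map_sum, map_smul, LinearMap.sum_apply, LinearMap.smul_apply, smul_eq_mul, map_zero,
    LinearMap.zero_apply, kroneckerPairing_cupProduct_ringChange, hQ] at h1
  simpa using h1

/-- **`Hᵏ(X; ℝ)` is spanned over `ℝ` by integral classes** (`X` a closed `ℤ`-oriented manifold of
dimension `k + k`): `rank (Hᵏ/T) = dim Hᵏ(X; ℝ)` independent integral classes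
(`linearIndependent_ringChange_of_basis`) span. Milnor–Husemoller (1973), §II.1 (the real form
`Q ⊗ ℝ`); Hatcher (2002), Cor. 3A.6. [cite: MilnorHusemoller1973, §II.1] -/
theorem span_range_ringChange_eq_top [ChartedSpace (EuclideanSpace ℝ (Fin n)) X]
    (μ : HomologicalOrientation ℤ X n) (h : k + k = n) :
    Submodule.span ℝ (Set.range (singularCohomology.ringChange (algebraMap ℤ ℝ) X k)) = ⊤ := by
  obtain ⟨hfin, hfree⟩ := finite_and_free_freeCohomology_int (X := X) (n := n) k
  haveI := hfin
  haveI := hfree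
  haveI : Module.Finite ℝ (singularCohomology ℝ ℝ X k) :=
    finite_singularCohomology_of_compact_chartedSpace ℝ ℝ (d := n) k
  set bF := Module.finBasis ℤ (freeCohomology ℤ X k)
  choose a ha using fun i ↦ freeCohomology.mk_surjective (R := ℤ) (X := X) (k := k) (bF i)
  have hli := linearIndependent_ringChange_of_basis μ h bF a ha
  have hcard : Fintype.card (Fin (Module.finrank ℤ (freeCohomology ℤ X k))) =
      Module.finrank ℝ (singularCohomology ℝ ℝ X k) := by
    rw [Fintype.card_fin, finrank_singularCohomology_real_eq_finrank_freeCohomology (n := n)]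
  have hspan := hli.span_eq_top_of_card_eq_finrank' hcard
  refine eq_top_iff.2 (hspan.ge.trans (Submodule.span_mono ?_))
  rintro _ ⟨i, rfl⟩
  exact ⟨a i, rfl⟩

/-- Every real class is a real combination of the integral lifts `aᵢ ⊗ 1` of a `ℤ`-basis of
`Hᵏ(X; ℤ)/T`. [cite: MilnorHusemoller1973, §II.1] -/
theorem exists_eq_sum_smul_ringChange [ChartedSpace (EuclideanSpace ℝ (Fin n)) X]
    (μ : HomologicalOrientation ℤ X n) (h : k + k = n) (y : singularCohomology ℝ ℝ X k) :
    ∃ (a : Fin (Module.finrank ℤ (freeCohomology ℤ X k)) → singularCohomology ℤ ℤ X k)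
      (r : Fin (Module.finrank ℤ (freeCohomology ℤ X k)) → ℝ),
      y = ∑ i, r i • singularCohomology.ringChange (algebraMap ℤ ℝ) X k (a i) := by
  obtain ⟨hfin, hfree⟩ := finite_and_free_freeCohomology_int (X := X) (n := n) k
  haveI := hfin
  haveI := hfree
  haveI : Module.Finite ℝ (singularCohomology ℝ ℝ X k) :=
    finite_singularCohomology_of_compact_chartedSpace ℝ ℝ (d := n) k
  set bF := Module.finBasis ℤ (freeCohomology ℤ X k)
  choose a ha using fun i ↦ freeCohomology.mk_surjective (R := ℤ) (X := X) (k := k) (bF i)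
  have hli := linearIndependent_ringChange_of_basis μ h bF a ha
  have hcard : Fintype.card (Fin (Module.finrank ℤ (freeCohomology ℤ X k))) =
      Module.finrank ℝ (singularCohomology ℝ ℝ X k) := by
    rw [Fintype.card_fin, finrank_singularCohomology_real_eq_finrank_freeCohomology (n := n)]
  have hspan := hli.span_eq_top_of_card_eq_finrank' hcard
  have hy : y ∈ Submodule.span ℝ (Set.range fun i ↦ singularCohomology.ringChange (algebraMap ℤ ℝ) X k (a i)) := by
    rw [hspan]; exact Submodule.mem_top
  obtain ⟨r, hr⟩ := (Submodule.mem_span_range_iff_exists_fun ℝ).1 hy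
  exact ⟨a, r, hr.symm⟩

end Span

/-! ### From a real class of positive square to an integral one -/

/-- A rational vector is an integer vector divided by a positive integer. [folklore] -/
theorem exists_eq_intCast_div_of_rat {ι : Type*} [Fintype ι] (q : ι → ℚ) :
    ∃ (d : ℕ) (m : ι → ℤ), 0 < d ∧ ∀ i, (q i : ℝ) = m i / d := by
  classical
  refine ⟨∏ i, (q i).den, fun i ↦ ((∏ i, (q i).den : ℕ) : ℚ) * q i |>.num, ?_, fun i ↦ ?_⟩
  · exact Finset.prod_pos fun i _ ↦ (q i).den_pos
  · have hden : ((q i).den : ℤ) ∣ ((∏ j, (q j).den : ℕ) : ℤ) := by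
      exact_mod_cast Finset.dvd_prod_of_mem (fun j ↦ (q j).den) (Finset.mem_univ i)
    have hint : ((((∏ j, (q j).den : ℕ) : ℚ) * q i).num : ℚ) = ((∏ j, (q j).den : ℕ) : ℚ) * q i := by
      obtain ⟨c, hc⟩ := hden
      have hq : ((∏ j, (q j).den : ℕ) : ℚ) * q i = (c * (q i).num : ℤ) := by
        have h1 : ((∏ j, (q j).den : ℕ) : ℚ) = ((q i).den : ℚ) * c := by exact_mod_cast hc
        rw [h1, mul_comm ((q i).den : ℚ), mul_assoc, Rat.den_mul_eq_num, Int.cast_mul]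
      rw [hq, Rat.num_intCast]
    have hpos : (0 : ℝ) < ((∏ j, (q j).den : ℕ) : ℝ) := by
      exact_mod_cast Finset.prod_pos fun j _ ↦ (q j).den_pos
    rw [eq_div_iff hpos.ne']
    have := congrArg (fun x : ℚ ↦ (x : ℝ)) hint
    simp only [Rat.cast_intCast, Rat.cast_mul, Rat.cast_natCast] at this
    rw [this, mul_comm]

/-- **An integral Gram form that is `≤ 0` on integer vectors is `≤ 0` on real vectors**
(`G` an integer matrix): `≤ 0` on `ℚᵇ` by homogeneity, on `ℝᵇ` by density of `ℚᵇ` and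
continuity. [folklore] -/
theorem sum_mul_mul_nonpos_of_int {ι : Type*} [Fintype ι] (G : ι → ι → ℝ)
    (hG : ∀ m : ι → ℤ, ∑ i, ∑ j, (m i : ℝ) * (m j : ℝ) * G i j ≤ 0) (r : ι → ℝ) :
    ∑ i, ∑ j, r i * r j * G i j ≤ 0 := by
  classical
  -- rational vectors
  have hQ : ∀ q : ι → ℚ, ∑ i, ∑ j, (q i : ℝ) * (q j : ℝ) * G i j ≤ 0 := by
    intro q
    obtain ⟨d, m, hd, hm⟩ := exists_eq_intCast_div_of_rat q
    have hd' : (0 : ℝ) < d := by exact_mod_cast hd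
    have heq : ∑ i, ∑ j, (q i : ℝ) * (q j : ℝ) * G i j =
        (∑ i, ∑ j, (m i : ℝ) * (m j : ℝ) * G i j) / (d : ℝ) ^ 2 := by
      rw [Finset.sum_div]
      refine Finset.sum_congr rfl fun i _ ↦ ?_
      rw [Finset.sum_div]
      refine Finset.sum_congr rfl fun j _ ↦ ?_
      rw [hm i, hm j]
      field_simp
    rw [heq]
    exact div_nonpos_of_nonpos_of_nonneg (hG m) (by positivity)
  -- density
  have hdense : DenseRange (Pi.map fun _ : ι ↦ ((↑) : ℚ → ℝ)) := DenseRange.piMap fun _ ↦ Rat.denseRange_cast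
  have hcont : Continuous fun r : ι → ℝ ↦ ∑ i, ∑ j, r i * r j * G i j := by
    refine continuous_finsetSum _ fun i _ ↦ continuous_finsetSum _ fun j _ ↦ ?_
    exact ((continuous_apply i).mul (continuous_apply j)).mul continuous_const
  have hclosed : IsClosed {r : ι → ℝ | ∑ i, ∑ j, r i * r j * G i j ≤ 0} :=
    isClosed_le hcont continuous_const
  have hsub : Set.range (Pi.map fun _ : ι ↦ ((↑) : ℚ → ℝ)) ⊆
      {r : ι → ℝ | ∑ i, ∑ j, r i * r j * G i j ≤ 0} := by
    rintro _ ⟨q, rfl⟩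
    exact hQ q
  have := hclosed.closure_subset_iff.2 hsub
  rw [hdense.closure_range] at this
  exact this (Set.mem_univ r)

variable [T2Space X] [CompactSpace X] [ChartedSpace (EuclideanSpace ℝ (Fin n)) X]

/-- **A real class of positive cup square yields an integral one.** On a closed `ℤ`-oriented
manifold of dimension `k + k`, if some `y ∈ Hᵏ(X; ℝ)` has `⟨y ∪ y, [X] ⊗ 1⟩ > 0` then some
integral class `a ∈ Hᵏ(X; ℤ)` has `⟨a ∪ a, [X]⟩ > 0`: write `y = ∑ rᵢ (aᵢ ⊗ 1)`
(`exists_eq_sum_smul_ringChange`); if all integral squares were `≤ 0`, the integral Gram form of the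
`aᵢ` would be `≤ 0` on `ℤᵇ`, hence on `ℝᵇ` (`sum_mul_mul_intCast_nonpos_of_int`), contradicting
`⟨y ∪ y, [X] ⊗ 1⟩ > 0`. Milnor–Husemoller (1973), §II.1–II.2 (an integral form and its real
extension have the same signature). [cite: MilnorHusemoller1973, §II.1–II.2] -/
theorem exists_cupPairing_self_pos_of_real (μ : HomologicalOrientation ℤ X n) (h : k + k = n)
    {y : singularCohomology ℝ ℝ X k}
    (hy : 0 < kroneckerPairing ℝ ℝ X n (cupProduct h y y)
      (singularHomology.coeffChange X (algebraMap ℤ ℝ : ℤ →+* ℝ).toAddMonoidHom n μ.fundamentalClass)) :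
    ∃ a : singularCohomology ℤ ℤ X k, 0 < cupPairing μ h a a := by
  by_contra hneg
  simp only [not_exists, not_lt] at hneg
  obtain ⟨a, r, rfl⟩ := exists_eq_sum_smul_ringChange μ h y
  rw [kroneckerPairing_cupProduct_sum_smul_ringChange] at hy
  have hG : ∀ m : Fin (Module.finrank ℤ (freeCohomology ℤ X k)) → ℤ,
      ∑ i, ∑ j, (m i : ℝ) * (m j : ℝ) * (cupPairing μ h (a i) (a j) : ℝ) ≤ 0 := fun m ↦ by
    rw [← kroneckerPairing_cupProduct_sum_smul_ringChange, ← ringChange_sum_zsmul,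
      kroneckerPairing_cupProduct_ringChange]
    exact_mod_cast hneg _
  exact absurd hy (not_lt.2 (sum_mul_mul_nonpos_of_int (fun i j ↦ (cupPairing μ h (a i) (a j) : ℝ)) hG r))

/-! ### `b⁺ ≥ 1` -/

/-- **An integral class of positive square gives `b⁺ ≥ 1`**: if `⟨a ∪ a, [X]⟩ > 0` then
`1 ≤ sigPos Q_X` — the rank-one sublattice `ℤ ā ⊆ Hᵏ(X; ℤ)/T` is positive definite
(Milnor–Husemoller (1973), §II.2; Gompf–Stipsicz (1999), §1.2: `b⁺` as the rank of a maximal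
positive definite sublattice, Mathlib's `sigPos`). [cite: MilnorHusemoller1973, §II.2] -/
theorem one_le_sigPos_intersectionForm_of_cupPairing_self_pos (μ : HomologicalOrientation ℤ X n)
    (h : k + k = n) {a : singularCohomology ℤ ℤ X k} (ha : 0 < cupPairing μ h a a) :
    1 ≤ sigPos (intersectionForm h μ).toQuadraticMap := by
  obtain ⟨hfin, -⟩ := finite_and_free_freeCohomology_int (X := X) (n := n) k
  haveI := hfin
  have hQ : 0 < intersectionForm h μ (freeCohomology.mk a) (freeCohomology.mk a) := by
    rwa [intersectionForm_mk_mk]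
  -- the rank-one sublattice spanned by `ā` is positive definite (`card_pos_le_sigPos`)
  have h1 := LinearMap.BilinForm.card_pos_le_sigPos (intersectionForm h μ) (fun _ : Fin 1 ↦ freeCohomology.mk a)
    (Subsingleton.pairwise)
  have hcard : Fintype.card {i : Fin 1 //
      0 < intersectionForm h μ (freeCohomology.mk a) (freeCohomology.mk a)} = 1 := by
    rw [Fintype.card_eq_one_iff]
    exact ⟨⟨0, hQ⟩, fun i ↦ Subtype.ext (Subsingleton.elim _ _)⟩
  rw [hcard] at h1
  exact h1

/-- **A real class of positive square gives `b⁺ ≥ 1`.** For a closed `ℤ`-oriented topological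
manifold `X` of dimension `k + k` (any `ℤ`-orientation `μ`): if some `y ∈ Hᵏ(X; ℝ)` has
`⟨y ∪ y, [X] ⊗ 1⟩ > 0`, then `1 ≤ sigPos Q_X` (Milnor–Husemoller (1973), §II.1–II.2;
Gompf–Stipsicz (1999), §1.2; the step "`[ω]² > 0 ⇒ b⁺ ≥ 1`" of McDuff–Salamon (2017), proof of
Thm. 13.3.11). [cite: MilnorHusemoller1973, §II.1–II.2] [cite: McDuffSalamon2017, proof of Thm. 13.3.11] -/
theorem one_le_sigPos_intersectionForm_of_real (μ : HomologicalOrientation ℤ X n) (h : k + k = n)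
    {y : singularCohomology ℝ ℝ X k}
    (hy : 0 < kroneckerPairing ℝ ℝ X n (cupProduct h y y)
      (singularHomology.coeffChange X (algebraMap ℤ ℝ : ℤ →+* ℝ).toAddMonoidHom n μ.fundamentalClass)) :
    1 ≤ sigPos (intersectionForm h μ).toQuadraticMap := by
  obtain ⟨a, ha⟩ := exists_cupPairing_self_pos_of_real μ h hy
  exact one_le_sigPos_intersectionForm_of_cupPairing_self_pos μ h ha

end Literature.Topology.FourManifolds
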